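/-
Copyright: the b2b-balaban T⁴-continuum CRUX team, row NE7b OWNER lineage `t4-ne7b-p1` (gen 121). Project licence.
-/
import Summits.QuantumFields.BalabanUV.T4Continuum.Spine.NE7b.SupTorusNextScaleModulus

/-!
# THE RESPONSE OF THE TORUS ROAD IS LIPSCHITZ IN THE BACKGROUND POTENTIAL, IN BLOCK MEAN SQUARE, EXPONENTIALLY LOCALLY — MESH- AND
# VOLUME-FREE: for `V₁, V₂ ≥ −λ` with `|V₁ − V₂| ≤ D` pointwise, the responses `h^i_{y₀} = Σ_{y′}T_i⁻¹(y′,y₀)ψ^i_{y′}` (`= Dt e_{y₀}` at the two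
# backgrounds, (100)∕(136)) satisfy `(n+1)^{−d}Σ_{B_y}(h¹_{y₀} − h²_{y₀})² ≤ C·D²·e^{−2δρ_s(y,y₀)}` for every block `y` — given the coarse floors,
# and UNCONDITIONALLY on the two-sided class, `(C, δ)` from `(d, a, λ, Λ)` only; with (141) (`H⁻¹`) and (142) (`T`, `T⁻¹`) this closes the
# regularity-in-the-background of the locality column for the road's response (row NE7b, node U5c; (131)–(142) BY NAME; [folklore])

Cell `pub-balaban`, sub-cell `t4`, spine estimate NE7b (`T4WeightBudget.RelWeightBound`; the cell's OWN estimate — NOT PRINTED in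
[Bałaban 1983–89], NOT PROVED).  Crux-route work under `Spine/NE7b/` by the row OWNER (`t4-ne7b-p1` gen 121, file (143)) under FREEZE
(0)'s crux-prover clause; NOTHING of Bałaban's is named as a Lean object, valued or asserted; no `T4Continuum/Support` leaf typed; no `def`,
no notation (both actions DISPLAYED; the responses WRITTEN OUT for abstract coarse kernels `M_i`, instantiated at `T_i⁻¹` = Mathlib's
inverse of `Matrix.of T_i`); zero `sorry`.  Imports (BY NAME): the OWNER's (142) `…SupTorusNextScaleModulus`
(`nextScale_hessian_lipschitz_of_floor`; through it (141) `blockSq_le_of_blockProfile_source`, `action_sub_of_potentials`, (137) `rate_mono`,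
`blockSq_le_of_decaying_source`, (135) `coarse_floor`, (134) `schur_inverse_decay`, (133) `action_sum_smul`, (131) `exists_rate`).

WHY (located).  `h¹ − h² = p + k` with `p = Σ_{y′}(T₁⁻¹ − T₂⁻¹)(y′,y₀)ψ¹_{y′}` and `k = Σ_{y′}T₂⁻¹(y′,y₀)(ψ¹ − ψ²)_{y′}`.  `p` solves `H_{V₁}p = c∘bt`
with the block-constant source `c = (T₁⁻¹ − T₂⁻¹)(·,y₀)` of size `C₂D` and rate `δ₂` ((142)), so (137) `blockSq_le_of_decaying_source` reads it;
`k` solves `H_{V₁}k = −(V₁ − V₂)·h²` (the displayed second resolvent identity (141) `action_sub_of_potentials`, column by column, and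
linearity (133)), a source with the BLOCK PROFILE `D·` that of `h²` — which (137) gives at the size `√((n+1)^d)` — so (141)
`blockSq_le_of_blockProfile_source` reads it at the halved rate; `(p + k)² ≤ 2p² + 2k²`; the block volume `(n+1)^d` is carried through and
divided out at the end (block MEAN square).  Rates: `κ₀` of (131), `(c₁, δ₁)` of (134), `(C₂, δ₂)` of (142), `δ = min(δ₁, δ₂)`,
`κ = min(κ₀, δ∕2)`, final rate `κ∕2`.

WHAT IS PROVED ([folklore]; fine torus `Site d ((n+1)s)`, coarse `Site d s`, `[NeZero s]`; both actions DISPLAYED; `bt x = σ_s(blk n (wm x))`;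
`H_{V_i}ψ^i_{y′} = 𝟙[bt · = y′]`; `h_i = Σ_{y′}M_i(y′,y₀)ψ^i_{y′}` for coarse kernels `M_i`; `m_κ = min(2,a) − λ − 2dκ² − a(e^{2dκ} − 1)`;
`K_α = (2∕(1 − e^{−α}))^d`; `ρ_s` = (132)'s distance written out):
* §1 `action_cross_term` (`H_{V₁}(Σ_{y′}M₂(y′,y₀)(ψ¹ − ψ²)_{y′}) = −(V₁ − V₂)·h₂`), **`response_sub_blockSq_le`** (`|M₂(·,y₀)| ≤ c₁e^{−δρ_s(·,y₀)}`,
  `|(M₁ − M₂)(·,y₀)| ≤ C₂De^{−δρ_s(·,y₀)}`, `|V₁ − V₂| ≤ D`, `V_i ≥ −λ`, `0 < κ ≤ 1`, `2κ ≤ δ`, `m_κ > 0` ⟹ `Σ_z (h₁ − h₂)(σ(chart (wm y) z))² ≤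
  (2m_κ⁻²C₂²e^{4dκ}K_δ + 2m_{κ∕2}⁻²m_κ⁻²c₁²e^{4dκ}K_δe^{2dκ}K_κ)·D²·(n+1)^d·e^{−κρ_s(y,y₀)}` for every block `y`).
* §2 **`response_lipschitz_of_floor`** (`a ≥ 0`, `λ < min(2,a)`, `γ > 0`: `∃ C δ > 0` such that for ALL `n, s`, `V₁, V₂ ≥ −λ` with `|V₁ − V₂| ≤ D`,
  block columns with the floors `γΣg² ≤ ⟨g,T_ig⟩`, `M_i = T_i⁻¹`, every `y₀, y`: `(n+1)^{−d}Σ_z (h₁ − h₂)(σ(chart (wm y) z))² ≤ CD²e^{−2δρ_s(y,y₀)}`),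
  THE HEADLINE **`response_lipschitz`** (the same UNCONDITIONALLY on the two-sided class `−λ ≤ V_i ≤ Λ`, `a > 0`; constants from `(d, a, λ, Λ)`).
* §3 toy.

HONEST (what this is NOT).  Block mean square (not pointwise — no `ℓ^∞` theory); Lipschitz only; the covariance's modulus is the same
computation once more ((139)'s split, not typed); the identification `h_{y₀} = Dt e_{y₀}` is by the displays ((133) `action_injective`,
(136)); constants explicit, far from sharp; cubic periods; scalar skeleton ((A3), NC-NE7b-α UNRULED); nothing of the covariant propagators;
nothing of Bałaban's.  BY-NAME EFFECT ON THE WALL: NONE.  NE7b NOT PRINTED ∕ NOT PROVED; spine PROVED 0∕9; rung (B)+1 on a FINITE torus —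
NOT infinite volume, NOT the mass gap, NOT Clay.  HONEST DEPENDENCY: continuum YM on T⁴ ⇐ BetaPertH ∧ nine spine estimates (0∕9 proved);
BetaPertH ⇐ (D1) ∧ (D4) ∧ CAP+tail; G-an2-4 gates asym, D1 and NE2∕3∕4.
-/

set_option autoImplicit false

noncomputable section

namespace Summit.QuantumFields.BalabanUV.T4Continuum.NE7b.SupTorusResponseModulus

open Real
open Literature.MathematicalPhysics.QuantumFieldTheory.Balaban1983to89
open B6QGQLower276 (X e blk B side chart mem_B sum_B sum_B_const card_cube blk_chart)
open Beta (Site siteOf windowMap siteOf_windowMap siteOf_add)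
open SupTorusHessianCombesThomas (exists_rate)
open SupTorusActionForm (action_sum_smul)
open SupTorusSchurComplement (schur_inverse_decay)
open SupTorusCoarseFloor (coarse_floor)
open SupTorusResponseLocality (rate_mono blockSq_le_of_decaying_source)
open SupTorusPropagatorModulus (blockSq_le_of_blockProfile_source action_sub_of_potentials)
open SupTorusNextScaleModulus (nextScale_hessian_lipschitz_of_floor)

variable {d : ℕ}

/-! ## §1. Two potentials, two families of block columns, two coarse kernels: the response is Lipschitz, in block `ℓ²` -/

section Response

variable (n : ℕ) (a : ℝ) (s : ℕ) [NeZero s] (ha : 0 ≤ a) {lam κ δ c₁ C₂ D : ℝ} (hκ0 : 0 < κ) (hκ1 : κ ≤ 1)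
  (hm : 0 < min 2 a - lam - 2 * d * κ ^ 2 - a * (exp (2 * d * κ) - 1)) (hδ : 0 < δ) (h2κ : 2 * κ ≤ δ)
  (V₁ V₂ : Site d ((n + 1) * s) → ℝ) (hV₁ : ∀ x, -lam ≤ V₁ x) (hV₂ : ∀ x, -lam ≤ V₂ x) (hD : ∀ x, |V₁ x - V₂ x| ≤ D)
  (ψ₁ ψ₂ : Site d s → Site d ((n + 1) * s) → ℝ)
  (hψ₁ : ∀ y' x, ((n : ℝ) + 1) ^ 2 * ∑ μ, (2 * ψ₁ y' x - ψ₁ y' (x + siteOf d ((n + 1) * s) (e μ)) - ψ₁ y' (x - siteOf d ((n + 1) * s) (e μ)))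
      + a / ((n : ℝ) + 1) ^ d * ∑ q ∈ B n (blk n (windowMap d ((n + 1) * s) x)), ψ₁ y' (siteOf d ((n + 1) * s) q) + V₁ x * ψ₁ y' x
      = if siteOf d s (blk n (windowMap d ((n + 1) * s) x)) = y' then 1 else 0)
  (hψ₂ : ∀ y' x, ((n : ℝ) + 1) ^ 2 * ∑ μ, (2 * ψ₂ y' x - ψ₂ y' (x + siteOf d ((n + 1) * s) (e μ)) - ψ₂ y' (x - siteOf d ((n + 1) * s) (e μ)))
      + a / ((n : ℝ) + 1) ^ d * ∑ q ∈ B n (blk n (windowMap d ((n + 1) * s) x)), ψ₂ y' (siteOf d ((n + 1) * s) q) + V₂ x * ψ₂ y' x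
      = if siteOf d s (blk n (windowMap d ((n + 1) * s) x)) = y' then 1 else 0)
  (M₁ M₂ : Site d s → Site d s → ℝ) (y₀ : Site d s)
  (hM₂ : ∀ y', |M₂ y' y₀| ≤ c₁ * exp (-(δ * ∑ i, (((y' i - y₀ i).valMinAbs.natAbs : ℕ) : ℝ))))
  (hM : ∀ y', |M₁ y' y₀ - M₂ y' y₀| ≤ C₂ * D * exp (-(δ * ∑ i, (((y' i - y₀ i).valMinAbs.natAbs : ℕ) : ℝ))))

include hψ₁ hψ₂ in
/-- **THE DIFFERENCE OF THE TWO RESPONSES SPLITS**: `h₁ − h₂ = p + k` with `p = Σ_{y′}(M₁ − M₂)(y′,y₀)ψ¹_{y′}` — `H_{V₁}p = (M₁ − M₂)(bt ·, y₀)`,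
a block-constant source — and `k = Σ_{y′}M₂(y′,y₀)(ψ¹ − ψ²)_{y′}` — `H_{V₁}k = −(V₁ − V₂)·h₂` by the displayed second resolvent identity
((141) `action_sub_of_potentials` per column). [folklore] -/
theorem action_cross_term (x : Site d ((n + 1) * s)) :
    ((n : ℝ) + 1) ^ 2 * ∑ μ, (2 * (∑ y', M₂ y' y₀ * (ψ₁ y' x - ψ₂ y' x))
        - (∑ y', M₂ y' y₀ * (ψ₁ y' (x + siteOf d ((n + 1) * s) (e μ)) - ψ₂ y' (x + siteOf d ((n + 1) * s) (e μ))))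
        - (∑ y', M₂ y' y₀ * (ψ₁ y' (x - siteOf d ((n + 1) * s) (e μ)) - ψ₂ y' (x - siteOf d ((n + 1) * s) (e μ)))))
      + a / ((n : ℝ) + 1) ^ d * ∑ q ∈ B n (blk n (windowMap d ((n + 1) * s) x)),
          (∑ y', M₂ y' y₀ * (ψ₁ y' (siteOf d ((n + 1) * s) q) - ψ₂ y' (siteOf d ((n + 1) * s) q)))
      + V₁ x * (∑ y', M₂ y' y₀ * (ψ₁ y' x - ψ₂ y' x))
      = -((V₁ x - V₂ x) * ∑ y', M₂ y' y₀ * ψ₂ y' x) := by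
  classical
  rw [action_sum_smul n a s Finset.univ (fun y' => M₂ y' y₀) (fun y' x => ψ₁ y' x - ψ₂ y' x) V₁ x]
  have hterm : ∀ y' : Site d s,
      ((n : ℝ) + 1) ^ 2 * ∑ μ, (2 * (ψ₁ y' x - ψ₂ y' x) - (ψ₁ y' (x + siteOf d ((n + 1) * s) (e μ)) - ψ₂ y' (x + siteOf d ((n + 1) * s) (e μ)))
          - (ψ₁ y' (x - siteOf d ((n + 1) * s) (e μ)) - ψ₂ y' (x - siteOf d ((n + 1) * s) (e μ))))
        + a / ((n : ℝ) + 1) ^ d * ∑ q ∈ B n (blk n (windowMap d ((n + 1) * s) x)), (ψ₁ y' (siteOf d ((n + 1) * s) q) - ψ₂ y' (siteOf d ((n + 1) * s) q))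
        + V₁ x * (ψ₁ y' x - ψ₂ y' x)
      = -((V₁ x - V₂ x) * ψ₂ y' x) := fun y' =>
    action_sub_of_potentials n a s V₁ V₂ (ψ₁ y') (ψ₂ y')
      (fun x => if siteOf d s (blk n (windowMap d ((n + 1) * s) x)) = y' then 1 else 0) (hψ₁ y') (hψ₂ y') x
  simp only [hterm]
  rw [Finset.mul_sum, ← Finset.sum_neg_distrib]
  exact Finset.sum_congr rfl fun y' _ => by ring

include ha hκ0 hκ1 hm hδ h2κ hV₁ hV₂ hD hψ₁ hψ₂ hM₂ hM in
/-- **THE RESPONSE IS LIPSCHITZ IN THE BACKGROUND, IN BLOCK `ℓ²`, MESH-FREE**: with `h_i = Σ_{y′}M_i(y′,y₀)ψ^i_{y′}` (the road's responses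
`Dt e_{y₀}` at the two backgrounds when `M_i = T_i⁻¹`), `|M₂(·,y₀)| ≤ c₁e^{−δρ_s(·,y₀)}`, `|(M₁ − M₂)(·,y₀)| ≤ C₂De^{−δρ_s(·,y₀)}`, `|V₁ − V₂| ≤ D`,
`0 < κ ≤ 1`, `2κ ≤ δ`, `m_κ > 0`: for EVERY block `y`, `Σ_z (h₁ − h₂)(σ(chart (wm y) z))² ≤ Const·D²·(n+1)^d·e^{−κρ_s(y,y₀)}` with
`Const = 2m_κ⁻²C₂²e^{4dκ}K_δ + 2m_{κ∕2}⁻²m_κ⁻²c₁²e^{4dκ}K_δe^{2dκ}K_κ` — block MEAN square `≤ Const·D²·e^{−κρ_s}`: (137) on `p`, (141) on `k`.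
[folklore] -/
theorem response_sub_blockSq_le (y : Site d s) :
    ∑ z : Fin d → Fin (n + 1), ((∑ y', M₁ y' y₀ * ψ₁ y' (siteOf d ((n + 1) * s) (chart n (windowMap d s y) z)))
        - (∑ y', M₂ y' y₀ * ψ₂ y' (siteOf d ((n + 1) * s) (chart n (windowMap d s y) z)))) ^ 2
      ≤ (2 * (((min 2 a - lam - 2 * d * κ ^ 2 - a * (exp (2 * d * κ) - 1))⁻¹) ^ 2 * (C₂ ^ 2 * exp (2 * d * κ)
            * (2 * (1 - exp (-δ))⁻¹) ^ d) * exp (2 * d * κ))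
        + 2 * (((min 2 a - lam - 2 * d * (κ / 2) ^ 2 - a * (exp (2 * d * (κ / 2)) - 1))⁻¹) ^ 2
            * ((((min 2 a - lam - 2 * d * κ ^ 2 - a * (exp (2 * d * κ) - 1))⁻¹) ^ 2 * (c₁ ^ 2 * exp (2 * d * κ)
              * (2 * (1 - exp (-δ))⁻¹) ^ d) * exp (2 * d * κ)) * exp (2 * d * (κ / 2)) * (2 * (1 - exp (-(2 * (κ / 2))))⁻¹) ^ d)
            * exp (2 * d * (κ / 2))))
        * D ^ 2 * ((n : ℝ) + 1) ^ d * exp (-(2 * (κ / 2) * ∑ i, (((y i - y₀ i).valMinAbs.natAbs : ℕ) : ℝ))) := by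
  classical
  have hvol : (0 : ℝ) < ((n : ℝ) + 1) ^ d := by positivity
  have hD0 : 0 ≤ D := (abs_nonneg _).trans (hD (siteOf d ((n + 1) * s) (chart n (windowMap d s y) 0)))
  have hρ0 : 0 ≤ ∑ i, (((y i - y₀ i).valMinAbs.natAbs : ℕ) : ℝ) := Finset.sum_nonneg fun _ _ => Nat.cast_nonneg _
  set p : Site d ((n + 1) * s) → ℝ := fun x => ∑ y', (M₁ y' y₀ - M₂ y' y₀) * ψ₁ y' x with hp
  set k : Site d ((n + 1) * s) → ℝ := fun x => ∑ y', M₂ y' y₀ * (ψ₁ y' x - ψ₂ y' x) with hk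
  set h₂ : Site d ((n + 1) * s) → ℝ := fun x => ∑ y', M₂ y' y₀ * ψ₂ y' x with hh₂
  -- the split `h₁ − h₂ = p + k`
  have hsplit : ∀ x, (∑ y', M₁ y' y₀ * ψ₁ y' x) - (∑ y', M₂ y' y₀ * ψ₂ y' x) = p x + k x := by
    intro x
    simp only [hp, hk]
    rw [← Finset.sum_sub_distrib, ← Finset.sum_add_distrib]
    exact Finset.sum_congr rfl fun y' _ => by ring
  -- `p`: block-constant source `(M₁ − M₂)(bt ·, y₀)`
  have hHp : ∀ x, ((n : ℝ) + 1) ^ 2 * ∑ μ, (2 * p x - p (x + siteOf d ((n + 1) * s) (e μ)) - p (x - siteOf d ((n + 1) * s) (e μ)))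
      + a / ((n : ℝ) + 1) ^ d * ∑ q ∈ B n (blk n (windowMap d ((n + 1) * s) x)), p (siteOf d ((n + 1) * s) q) + V₁ x * p x
      = (fun y' => M₁ y' y₀ - M₂ y' y₀) (siteOf d s (blk n (windowMap d ((n + 1) * s) x))) := by
    intro x
    simp only [hp]
    rw [action_sum_smul n a s Finset.univ (fun y' => M₁ y' y₀ - M₂ y' y₀) ψ₁ V₁ x]
    simp only [hψ₁, mul_ite, mul_one, mul_zero, Finset.sum_ite_eq, Finset.mem_univ, if_true]
  have hP := blockSq_le_of_decaying_source n s a ha hκ0.le hκ1 hm hδ h2κ V₁ hV₁ y₀ (fun y' => M₁ y' y₀ - M₂ y' y₀)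
    (fun y' => hM y') p hHp y
  -- `h₂`: block profile from (137)
  have hH₂ : ∀ x, ((n : ℝ) + 1) ^ 2 * ∑ μ, (2 * h₂ x - h₂ (x + siteOf d ((n + 1) * s) (e μ)) - h₂ (x - siteOf d ((n + 1) * s) (e μ)))
      + a / ((n : ℝ) + 1) ^ d * ∑ q ∈ B n (blk n (windowMap d ((n + 1) * s) x)), h₂ (siteOf d ((n + 1) * s) q) + V₂ x * h₂ x
      = (fun y' => M₂ y' y₀) (siteOf d s (blk n (windowMap d ((n + 1) * s) x))) := by
    intro x
    simp only [hh₂]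
    rw [action_sum_smul n a s Finset.univ (fun y' => M₂ y' y₀) ψ₂ V₂ x]
    simp only [hψ₂, mul_ite, mul_one, mul_zero, Finset.sum_ite_eq, Finset.mem_univ, if_true]
  have hB₂ := blockSq_le_of_decaying_source n s a ha hκ0.le hκ1 hm hδ h2κ V₂ hV₂ y₀ (fun y' => M₂ y' y₀) hM₂ h₂ hH₂
  -- `k`: source `−(V₁ − V₂)h₂` with block profile `D·(profile of h₂)`
  set G2 : ℝ := D ^ 2 * (((min 2 a - lam - 2 * d * κ ^ 2 - a * (exp (2 * d * κ) - 1))⁻¹) ^ 2 * (c₁ ^ 2 * ((n : ℝ) + 1) ^ d * exp (2 * d * κ)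
      * (2 * (1 - exp (-δ))⁻¹) ^ d) * exp (2 * d * κ)) with hG2
  have hG20 : 0 ≤ G2 := by
    have : 0 ≤ (2 * (1 - exp (-δ))⁻¹) ^ d := pow_nonneg (mul_nonneg zero_le_two (inv_nonneg.2 (sub_nonneg.2 (exp_le_one_iff.2 (by linarith))))) d
    positivity
  have hg : ∀ y'' : Site d s, ∑ z : Fin d → Fin (n + 1),
      (-((V₁ (siteOf d ((n + 1) * s) (chart n (windowMap d s y'') z)) - V₂ (siteOf d ((n + 1) * s) (chart n (windowMap d s y'') z)))
        * h₂ (siteOf d ((n + 1) * s) (chart n (windowMap d s y'') z)))) ^ 2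
      ≤ (√G2) ^ 2 * exp (-(2 * κ * ∑ i, (((y'' i - y₀ i).valMinAbs.natAbs : ℕ) : ℝ))) := by
    intro y''
    rw [Real.sq_sqrt hG20]
    calc ∑ z : Fin d → Fin (n + 1),
          (-((V₁ (siteOf d ((n + 1) * s) (chart n (windowMap d s y'') z)) - V₂ (siteOf d ((n + 1) * s) (chart n (windowMap d s y'') z)))
            * h₂ (siteOf d ((n + 1) * s) (chart n (windowMap d s y'') z)))) ^ 2
        ≤ ∑ z : Fin d → Fin (n + 1), D ^ 2 * h₂ (siteOf d ((n + 1) * s) (chart n (windowMap d s y'') z)) ^ 2 := by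
          refine Finset.sum_le_sum fun z _ => ?_
          rw [neg_sq, mul_pow, ← sq_abs (V₁ _ - V₂ _)]
          exact mul_le_mul_of_nonneg_right (pow_le_pow_left₀ (abs_nonneg _) (hD _) 2) (sq_nonneg _)
      _ = D ^ 2 * ∑ z : Fin d → Fin (n + 1), h₂ (siteOf d ((n + 1) * s) (chart n (windowMap d s y'') z)) ^ 2 := (Finset.mul_sum _ _ _).symm
      _ ≤ D ^ 2 * (((min 2 a - lam - 2 * d * κ ^ 2 - a * (exp (2 * d * κ) - 1))⁻¹) ^ 2 * (c₁ ^ 2 * ((n : ℝ) + 1) ^ d * exp (2 * d * κ)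
          * (2 * (1 - exp (-δ))⁻¹) ^ d) * exp (2 * d * κ) * exp (-(2 * κ * ∑ i, (((y'' i - y₀ i).valMinAbs.natAbs : ℕ) : ℝ)))) :=
          mul_le_mul_of_nonneg_left (hB₂ y'') (sq_nonneg _)
      _ = _ := by rw [hG2]; ring
  have hκ'0 : 0 < κ / 2 := by linarith
  have hκ'1 : κ / 2 ≤ 1 := by linarith
  have hm' : 0 < min 2 a - lam - 2 * d * (κ / 2) ^ 2 - a * (exp (2 * d * (κ / 2)) - 1) :=
    lt_of_lt_of_le hm (rate_mono (d := d) a ha hκ'0.le (by linarith))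
  have hK := blockSq_le_of_blockProfile_source n a s ha hκ'0 hκ'1 hm' (by linarith) V₁ hV₁ y₀ k
    (fun x => -((V₁ x - V₂ x) * h₂ x)) hg (fun x => action_cross_term n a s V₁ V₂ ψ₁ ψ₂ hψ₁ hψ₂ M₂ y₀ x) y
  rw [Real.sq_sqrt hG20] at hK
  -- assemble: `(p + k)² ≤ 2p² + 2k²`, rate `κ∕2 ≤ κ`
  have hexp : exp (-(2 * κ * ∑ i, (((y i - y₀ i).valMinAbs.natAbs : ℕ) : ℝ)))
      ≤ exp (-(2 * (κ / 2) * ∑ i, (((y i - y₀ i).valMinAbs.natAbs : ℕ) : ℝ))) := exp_le_exp.2 (by nlinarith)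
  have hsum : ∑ z : Fin d → Fin (n + 1), ((∑ y', M₁ y' y₀ * ψ₁ y' (siteOf d ((n + 1) * s) (chart n (windowMap d s y) z)))
        - (∑ y', M₂ y' y₀ * ψ₂ y' (siteOf d ((n + 1) * s) (chart n (windowMap d s y) z)))) ^ 2
      ≤ 2 * ∑ z : Fin d → Fin (n + 1), p (siteOf d ((n + 1) * s) (chart n (windowMap d s y) z)) ^ 2
        + 2 * ∑ z : Fin d → Fin (n + 1), k (siteOf d ((n + 1) * s) (chart n (windowMap d s y) z)) ^ 2 := by
    rw [Finset.mul_sum, Finset.mul_sum, ← Finset.sum_add_distrib]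
    refine Finset.sum_le_sum fun z _ => ?_
    rw [hsplit]
    nlinarith [sq_nonneg (p (siteOf d ((n + 1) * s) (chart n (windowMap d s y) z)) - k (siteOf d ((n + 1) * s) (chart n (windowMap d s y) z)))]
  refine hsum.trans ?_
  have hKδ0 : 0 ≤ (2 * (1 - exp (-δ))⁻¹) ^ d :=
    pow_nonneg (mul_nonneg zero_le_two (inv_nonneg.2 (sub_nonneg.2 (exp_le_one_iff.2 (by linarith))))) d
  have hA0 : 0 ≤ ((min 2 a - lam - 2 * d * κ ^ 2 - a * (exp (2 * d * κ) - 1))⁻¹) ^ 2 * ((C₂ * D) ^ 2 * ((n : ℝ) + 1) ^ d * exp (2 * d * κ)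
      * (2 * (1 - exp (-δ))⁻¹) ^ d) * exp (2 * d * κ) := by positivity
  have hP' := hP.trans (mul_le_mul_of_nonneg_left hexp hA0)
  linarith [hP', hK]

end Response

/-! ## §2. THE END: the road's response is Lipschitz in the background — given the coarse floors, and unconditionally on the two-sided class -/

/-- **THE RESPONSE `Dt e_{y₀}` IS LIPSCHITZ IN THE BACKGROUND POTENTIAL, IN BLOCK MEAN SQUARE, EXPONENTIALLY LOCALLY — GIVEN THE COARSE
FLOORS.**  Fix `d`, `a ≥ 0`, `λ < min(2,a)`, `γ > 0`.  THERE ARE `C, δ > 0` (functions of these only) such that for ALL `n, s`, ALL `V₁, V₂ ≥ −λ`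
with `|V₁ − V₂| ≤ D`, ALL block columns `ψ^i` (`H_{V_i}ψ^i_{y′} = 𝟙[bt · = y′]`) whose Schur complements have the floor `γ`, every `y₀` and every
block `y`: the responses `h_i = Σ_{y′}T_i⁻¹(y′,y₀)ψ^i_{y′}` satisfy `(n+1)^{−d}Σ_z (h₁ − h₂)(σ(chart (wm y) z))² ≤ C·D²·e^{−2δρ_s(y,y₀)}` — (131)
`exists_rate`, (134) `schur_inverse_decay`, (142) `nextScale_hessian_lipschitz_of_floor`, §1. [folklore] -/
theorem response_lipschitz_of_floor (a : ℝ) (ha : 0 ≤ a) {lam γ : ℝ} (hm0 : 0 < min 2 a - lam) (hγ : 0 < γ) :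
    ∃ C δ : ℝ, 0 < C ∧ 0 < δ ∧ ∀ (n s : ℕ) [NeZero s] (V₁ V₂ : Site d ((n + 1) * s) → ℝ), (∀ x, -lam ≤ V₁ x) → (∀ x, -lam ≤ V₂ x) →
      ∀ D : ℝ, (∀ x, |V₁ x - V₂ x| ≤ D) →
      ∀ ψ₁ ψ₂ : Site d s → Site d ((n + 1) * s) → ℝ,
      (∀ y' x, ((n : ℝ) + 1) ^ 2 * ∑ μ, (2 * ψ₁ y' x - ψ₁ y' (x + siteOf d ((n + 1) * s) (e μ)) - ψ₁ y' (x - siteOf d ((n + 1) * s) (e μ)))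
        + a / ((n : ℝ) + 1) ^ d * ∑ q ∈ B n (blk n (windowMap d ((n + 1) * s) x)), ψ₁ y' (siteOf d ((n + 1) * s) q) + V₁ x * ψ₁ y' x
        = if siteOf d s (blk n (windowMap d ((n + 1) * s) x)) = y' then 1 else 0) →
      (∀ y' x, ((n : ℝ) + 1) ^ 2 * ∑ μ, (2 * ψ₂ y' x - ψ₂ y' (x + siteOf d ((n + 1) * s) (e μ)) - ψ₂ y' (x - siteOf d ((n + 1) * s) (e μ)))
        + a / ((n : ℝ) + 1) ^ d * ∑ q ∈ B n (blk n (windowMap d ((n + 1) * s) x)), ψ₂ y' (siteOf d ((n + 1) * s) q) + V₂ x * ψ₂ y' x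
        = if siteOf d s (blk n (windowMap d ((n + 1) * s) x)) = y' then 1 else 0) →
      (∀ g : Site d s → ℝ, γ * ∑ y, g y ^ 2
        ≤ ∑ y, g y * ∑ y', ((((n : ℝ) + 1) ^ d)⁻¹ * ∑ z : Fin d → Fin (n + 1), ψ₁ y' (siteOf d ((n + 1) * s) (chart n (windowMap d s y) z))) * g y') →
      (∀ g : Site d s → ℝ, γ * ∑ y, g y ^ 2
        ≤ ∑ y, g y * ∑ y', ((((n : ℝ) + 1) ^ d)⁻¹ * ∑ z : Fin d → Fin (n + 1), ψ₂ y' (siteOf d ((n + 1) * s) (chart n (windowMap d s y) z))) * g y') →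
      ∀ y₀ y : Site d s,
        (((n : ℝ) + 1) ^ d)⁻¹ * ∑ z : Fin d → Fin (n + 1), ((∑ y', (Matrix.of fun yy y'' : Site d s =>
              (((n : ℝ) + 1) ^ d)⁻¹ * ∑ z : Fin d → Fin (n + 1), ψ₁ y'' (siteOf d ((n + 1) * s) (chart n (windowMap d s yy) z)))⁻¹ y' y₀
              * ψ₁ y' (siteOf d ((n + 1) * s) (chart n (windowMap d s y) z)))
          - (∑ y', (Matrix.of fun yy y'' : Site d s =>
              (((n : ℝ) + 1) ^ d)⁻¹ * ∑ z : Fin d → Fin (n + 1), ψ₂ y'' (siteOf d ((n + 1) * s) (chart n (windowMap d s yy) z)))⁻¹ y' y₀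
              * ψ₂ y' (siteOf d ((n + 1) * s) (chart n (windowMap d s y) z)))) ^ 2
          ≤ C * D ^ 2 * exp (-(2 * δ * ∑ i, (((y i - y₀ i).valMinAbs.natAbs : ℕ) : ℝ))) := by
  classical
  have hd : (0 : ℝ) ≤ d := Nat.cast_nonneg d
  obtain ⟨κ₀, hκ₀0, hκ₀1, hκ₀m⟩ := exists_rate (d := d) a ha hm0
  have hmκ₀ : 0 < min 2 a - lam - 2 * d * κ₀ ^ 2 - a * (exp (2 * d * κ₀) - 1) := by linarith
  obtain ⟨c₁, δ₁, hc₁, hδ₁, H134⟩ := schur_inverse_decay (d := d) a ha hκ₀0 hκ₀1 hmκ₀ hγ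
  obtain ⟨C₂, δ₂, hC₂, hδ₂, H142⟩ := nextScale_hessian_lipschitz_of_floor (d := d) a ha hm0 hγ
  set δ : ℝ := min δ₁ δ₂ with hδ_def
  have hδ0 : 0 < δ := lt_min hδ₁ hδ₂
  have hδδ₁ : δ ≤ δ₁ := min_le_left _ _
  have hδδ₂ : δ ≤ δ₂ := min_le_right _ _
  set κ : ℝ := min κ₀ (δ / 2) with hκ_def
  have hκ0 : 0 < κ := lt_min hκ₀0 (by linarith)
  have hκκ₀ : κ ≤ κ₀ := min_le_left _ _
  have hκ1 : κ ≤ 1 := hκκ₀.trans hκ₀1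
  have h2κ : 2 * κ ≤ δ := by have := min_le_right κ₀ (δ / 2); rw [← hκ_def] at this; linarith
  have hm : 0 < min 2 a - lam - 2 * d * κ ^ 2 - a * (exp (2 * d * κ) - 1) :=
    lt_of_lt_of_le hmκ₀ (rate_mono (d := d) a ha hκ0.le hκκ₀)
  set Kδ : ℝ := (2 * (1 - exp (-δ))⁻¹) ^ d with hKδ
  set Kκ : ℝ := (2 * (1 - exp (-(2 * (κ / 2))))⁻¹) ^ d with hKκ
  have hKδ0 : 0 ≤ Kδ := pow_nonneg (mul_nonneg zero_le_two (inv_nonneg.2 (sub_nonneg.2 (exp_le_one_iff.2 (by linarith))))) d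
  have hKκ0 : 0 ≤ Kκ := pow_nonneg (mul_nonneg zero_le_two (inv_nonneg.2 (sub_nonneg.2 (exp_le_one_iff.2 (by linarith))))) d
  set Const : ℝ := 2 * (((min 2 a - lam - 2 * d * κ ^ 2 - a * (exp (2 * d * κ) - 1))⁻¹) ^ 2 * (C₂ ^ 2 * exp (2 * d * κ) * Kδ)
        * exp (2 * d * κ))
      + 2 * (((min 2 a - lam - 2 * d * (κ / 2) ^ 2 - a * (exp (2 * d * (κ / 2)) - 1))⁻¹) ^ 2
        * ((((min 2 a - lam - 2 * d * κ ^ 2 - a * (exp (2 * d * κ) - 1))⁻¹) ^ 2 * (c₁ ^ 2 * exp (2 * d * κ) * Kδ) * exp (2 * d * κ))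
          * exp (2 * d * (κ / 2)) * Kκ) * exp (2 * d * (κ / 2))) with hConst
  have hConst0 : 0 ≤ Const := by positivity
  refine ⟨Const + 1, κ / 2, by positivity, by linarith, ?_⟩
  intro n s _ V₁ V₂ hV₁ hV₂ D hD ψ₁ ψ₂ hψ₁ hψ₂ hfl₁ hfl₂ y₀ y
  set T₁ : Matrix (Site d s) (Site d s) ℝ := Matrix.of fun yy y'' : Site d s =>
    (((n : ℝ) + 1) ^ d)⁻¹ * ∑ z : Fin d → Fin (n + 1), ψ₁ y'' (siteOf d ((n + 1) * s) (chart n (windowMap d s yy) z)) with hT₁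
  set T₂ : Matrix (Site d s) (Site d s) ℝ := Matrix.of fun yy y'' : Site d s =>
    (((n : ℝ) + 1) ^ d)⁻¹ * ∑ z : Fin d → Fin (n + 1), ψ₂ y'' (siteOf d ((n + 1) * s) (chart n (windowMap d s yy) z)) with hT₂
  have hvol : (0 : ℝ) < ((n : ℝ) + 1) ^ d := by positivity
  have hD0 : 0 ≤ D := (abs_nonneg _).trans (hD (siteOf d ((n + 1) * s) (chart n (windowMap d s y) 0)))
  -- the two kernel letters at the common rate `δ`
  have hM₂ : ∀ y', |T₂⁻¹ y' y₀| ≤ c₁ * exp (-(δ * ∑ i, (((y' i - y₀ i).valMinAbs.natAbs : ℕ) : ℝ))) := by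
    intro y'
    have hρ : 0 ≤ ∑ i, (((y' i - y₀ i).valMinAbs.natAbs : ℕ) : ℝ) := Finset.sum_nonneg fun _ _ => Nat.cast_nonneg _
    refine (H134 n s V₂ hV₂ ψ₂ hψ₂ hfl₂ y' y₀).trans (mul_le_mul_of_nonneg_left (exp_le_exp.2 ?_) hc₁.le)
    nlinarith [mul_le_mul_of_nonneg_right hδδ₁ hρ]
  have hM : ∀ y', |T₁⁻¹ y' y₀ - T₂⁻¹ y' y₀| ≤ C₂ * D * exp (-(δ * ∑ i, (((y' i - y₀ i).valMinAbs.natAbs : ℕ) : ℝ))) := by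
    intro y'
    have hρ : 0 ≤ ∑ i, (((y' i - y₀ i).valMinAbs.natAbs : ℕ) : ℝ) := Finset.sum_nonneg fun _ _ => Nat.cast_nonneg _
    have h := (H142 n s V₁ V₂ hV₁ hV₂ D hD ψ₁ ψ₂ hψ₁ hψ₂ hfl₁ hfl₂ y' y₀).2
    refine h.trans (mul_le_mul_of_nonneg_left (exp_le_exp.2 ?_) (by positivity))
    nlinarith [mul_le_mul_of_nonneg_right hδδ₂ hρ]
  have hmain := response_sub_blockSq_le n a s ha hκ0 hκ1 hm hδ0 h2κ V₁ V₂ hV₁ hV₂ hD ψ₁ ψ₂ hψ₁ hψ₂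
    (fun y' y'' => T₁⁻¹ y' y'') (fun y' y'' => T₂⁻¹ y' y'') y₀ hM₂ hM y
  rw [inv_mul_le_iff₀ hvol]
  refine hmain.trans ?_
  have hE0 : 0 ≤ exp (-(2 * (κ / 2) * ∑ i, (((y i - y₀ i).valMinAbs.natAbs : ℕ) : ℝ))) := (exp_pos _).le
  have hrew : Const * D ^ 2 * ((n : ℝ) + 1) ^ d * exp (-(2 * (κ / 2) * ∑ i, (((y i - y₀ i).valMinAbs.natAbs : ℕ) : ℝ)))
      = ((n : ℝ) + 1) ^ d * (Const * D ^ 2 * exp (-(2 * (κ / 2) * ∑ i, (((y i - y₀ i).valMinAbs.natAbs : ℕ) : ℝ)))) := by ring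
  rw [hrew]
  exact mul_le_mul_of_nonneg_left (mul_le_mul_of_nonneg_right (mul_le_mul_of_nonneg_right (le_add_of_nonneg_right zero_le_one)
    (sq_nonneg _)) hE0) hvol.le

/-- **HEADLINE — ON THE TWO-SIDED CLASS THE RESPONSE IS LIPSCHITZ IN THE BACKGROUND, UNCONDITIONALLY**: for `a > 0`, `λ < min(2,a)`,
`Λ ≥ 0` there are `C, δ > 0` from `(d, a, λ, Λ)` only such that the conclusion of `response_lipschitz_of_floor` holds for ALL `n, s`, ALL
`−λ ≤ V₁, V₂ ≤ Λ` with `|V₁ − V₂| ≤ D` and their block columns — the floors are (135) `coarse_floor`. [folklore] -/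
theorem response_lipschitz (a : ℝ) (ha : 0 < a) {lam Lam : ℝ} (hm0 : 0 < min 2 a - lam) (hLam : 0 ≤ Lam) :
    ∃ C δ : ℝ, 0 < C ∧ 0 < δ ∧ ∀ (n s : ℕ) [NeZero s] (V₁ V₂ : Site d ((n + 1) * s) → ℝ), (∀ x, -lam ≤ V₁ x) → (∀ x, -lam ≤ V₂ x) →
      (∀ x, V₁ x ≤ Lam) → (∀ x, V₂ x ≤ Lam) → ∀ D : ℝ, (∀ x, |V₁ x - V₂ x| ≤ D) →
      ∀ ψ₁ ψ₂ : Site d s → Site d ((n + 1) * s) → ℝ,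
      (∀ y' x, ((n : ℝ) + 1) ^ 2 * ∑ μ, (2 * ψ₁ y' x - ψ₁ y' (x + siteOf d ((n + 1) * s) (e μ)) - ψ₁ y' (x - siteOf d ((n + 1) * s) (e μ)))
        + a / ((n : ℝ) + 1) ^ d * ∑ q ∈ B n (blk n (windowMap d ((n + 1) * s) x)), ψ₁ y' (siteOf d ((n + 1) * s) q) + V₁ x * ψ₁ y' x
        = if siteOf d s (blk n (windowMap d ((n + 1) * s) x)) = y' then 1 else 0) →
      (∀ y' x, ((n : ℝ) + 1) ^ 2 * ∑ μ, (2 * ψ₂ y' x - ψ₂ y' (x + siteOf d ((n + 1) * s) (e μ)) - ψ₂ y' (x - siteOf d ((n + 1) * s) (e μ)))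
        + a / ((n : ℝ) + 1) ^ d * ∑ q ∈ B n (blk n (windowMap d ((n + 1) * s) x)), ψ₂ y' (siteOf d ((n + 1) * s) q) + V₂ x * ψ₂ y' x
        = if siteOf d s (blk n (windowMap d ((n + 1) * s) x)) = y' then 1 else 0) →
      ∀ y₀ y : Site d s,
        (((n : ℝ) + 1) ^ d)⁻¹ * ∑ z : Fin d → Fin (n + 1), ((∑ y', (Matrix.of fun yy y'' : Site d s =>
              (((n : ℝ) + 1) ^ d)⁻¹ * ∑ z : Fin d → Fin (n + 1), ψ₁ y'' (siteOf d ((n + 1) * s) (chart n (windowMap d s yy) z)))⁻¹ y' y₀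
              * ψ₁ y' (siteOf d ((n + 1) * s) (chart n (windowMap d s y) z)))
          - (∑ y', (Matrix.of fun yy y'' : Site d s =>
              (((n : ℝ) + 1) ^ d)⁻¹ * ∑ z : Fin d → Fin (n + 1), ψ₂ y'' (siteOf d ((n + 1) * s) (chart n (windowMap d s yy) z)))⁻¹ y' y₀
              * ψ₂ y' (siteOf d ((n + 1) * s) (chart n (windowMap d s y) z)))) ^ 2
          ≤ C * D ^ 2 * exp (-(2 * δ * ∑ i, (((y i - y₀ i).valMinAbs.natAbs : ℕ) : ℝ))) := by
  have hd : (0 : ℝ) ≤ d := Nat.cast_nonneg d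
  have hγ : 0 < 1 / ((36 : ℝ) ^ d * (4 * d + a + Lam)) := by positivity
  obtain ⟨C, δ, hC, hδ, H⟩ := response_lipschitz_of_floor (d := d) a ha.le hm0 hγ
  exact ⟨C, δ, hC, hδ, fun n s _ V₁ V₂ hV₁ hV₂ hV₁' hV₂' D hD ψ₁ ψ₂ hψ₁ hψ₂ y₀ y =>
    H n s V₁ V₂ hV₁ hV₂ D hD ψ₁ ψ₂ hψ₁ hψ₂ (coarse_floor n a s ha (by linarith) hLam V₁ hV₁ hV₁' ψ₁ hψ₁)
      (coarse_floor n a s ha (by linarith) hLam V₂ hV₂ hV₂' ψ₂ hψ₂) y₀ y⟩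

/-! ## §3. Toy -/

/-- Toy (`d = 0`, `a = 1`, `λ = 0`, `Λ = 0`): the headline's hypotheses are inhabited, so the constants exist. -/
example : ∃ C δ : ℝ, 0 < C ∧ 0 < δ :=
  let ⟨C, δ, hC, hδ, _⟩ := response_lipschitz (d := 0) 1 one_pos (lam := 0) (Lam := 0) (by norm_num) le_rfl; ⟨C, δ, hC, hδ⟩


end Summit.QuantumFields.BalabanUV.T4Continuum.NE7b.SupTorusResponseModulus
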